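import Summits.MatrixMultiplication.OmegaCensus.STPP222CubeProdEnc

/-!
# ω-census, `(2,2,2)³` in `ZMod 2 × (ZMod 2 × (ZMod 2 × ZMod 3))` — the code list (data shared by the search parts)

HONEST FRAMING (pub-omega census; verbatim): lottery ticket; floor = certified bounds/negative ranges.
Census STRUCTURE bookkeeping (question Q7, row `k = 3`), not progress on `ω`.  Generated by ENG2 gen 18's `prodgen3.py`.

This file RE-DECLARES, under the names `E2_2_2_3b` / `el2_2_2_3b`, the data of `STPP222CubeNone_2_2_2_3El.lean` (accepted, olean never
built — pub-omega OPS-REQUESTS addendum 9) so that its parts can be checked; the two declarations are definitionally the same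
encoding and the same list as `E2_2_2_3` / `el2_2_2_3` there (ENG2 gen 20, lead ruling L23-3).
-/

namespace Summit.MatrixMultiplication.OmegaCensus

namespace STPP222CubeNeg

/-- The slot-padded encoding of `ZMod 2 × (ZMod 2 × (ZMod 2 × ZMod 3))` (slot widths [16, 11, 6]). -/
def E2_2_2_3b : Enc3 (ZMod 2 × (ZMod 2 × (ZMod 2 × ZMod 3))) :=
  (prodEnc3 (zEnc 2) (prodEnc3 (zEnc 2) (prodEnc3 (zEnc 2) (zEnc 3) 6 (by decide)) 11 (by decide)) 16 (by decide))

/-- All codes of `ZMod 2 × (ZMod 2 × (ZMod 2 × ZMod 3))` under the padded encoding, increasing (data). -/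
def el2_2_2_3b : List ℕ :=
  [0, 1, 2, 64, 65, 66, 2048, 2049, 2050, 2112, 2113, 2114, 65536, 65537, 65538, 65600, 65601, 65602, 67584, 67585,
    67586, 67648, 67649, 67650]

end STPP222CubeNeg

end Summit.MatrixMultiplication.OmegaCensus
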